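import Mathlib
import Summits.NavierStokesRegularity.NavierStokesRegularity.Theses.ComplexTouchdown
import HarnessLib

/-!
# `ComplexTouchdown.Assembly` — the route's assembly (item stmt-NavierStokesRegularity-1560; pure
  logic)

**Statement.** `TouchdownDichotomy → NoSheetTouchdown → NoScaleFreeTouchdown → SingularPointOfBlowup
→ NoBlowupToClay → NavierStokesRegularity`.

PROOF. The route file `Theses/ComplexTouchdown.lean` carries the planner-authored, kernel-checked
deciding theorem `Theses.ComplexTouchdown.closes`, whose hypotheses are exactly the route's items
and whose conclusion is the registered leaf; the assembly item is that implication written as ONE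
proposition, so it is closed by applying `closes` to the hypotheses.

HONEST FRAMING: glue between the route's own statements (about HYPOTHETICAL objects); nothing
here bears on the regularity problem itself.
-/

noncomputable section

set_option linter.dupNamespace false

namespace Summit.NavierStokesRegularity.NavierStokesRegularity.Theorems

open Summit.NavierStokesRegularity.NavierStokesRegularity.Theses.ComplexTouchdown in
/-- **Item stmt-NavierStokesRegularity-1560** (`ComplexTouchdown.Assembly`): the route's chain of
items implies its registered leaf, by the route file's deciding theorem `closes`. [this file] -/
theorem complexTouchdown_assembly_proof :
    Summit.NavierStokesRegularity.NavierStokesRegularity.Theses.ComplexTouchdown.Assembly := by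
  unfold Summit.NavierStokesRegularity.NavierStokesRegularity.Theses.ComplexTouchdown.Assembly
  intro hD hS hF hP hClay
  exact closes hD hS hF hP hClay

end Summit.NavierStokesRegularity.NavierStokesRegularity.Theorems

end
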